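import Summits.QuantumFields.YangMills.Theorems.LangevinControlUVFemtoCurvatureTwoPointCDefsScalingCore
import Summits.QuantumFields.YangMills.Theorems.LangevinControlUVFemtoCurvatureTwoPointCCoreBridge
import Summits.QuantumFields.YangMills.Theorems.LangevinControlUVFemtoCurvatureTwoPointCStubTwoLoopAdmissible
import Summits.QuantumFields.YangMills.Theorems.LangevinControlUVFemtoCurvatureTwoPointCStubTwoLoopStepLaw
import Summits.QuantumFields.YangMills.Theorems.LangevinControlUVFemtoCurvatureTwoPointCTwoLoopBareSize

/-!
# Route `LangevinControlUV`, crux `FemtoCurvatureTwoPointC` (stmt-QuantumFields-16204), line `Sketch` — the explicit two-loop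
# coupling is an admissible AF coupling on femto boxes, interior form: `AsymptoticScalingCoreAt r → AFProfilesCoreAt r`

Continuation lead `prover-line-stmt-QuantumFields-16204-c4-0`, cycle 6 (vocabulary `…CDefsScalingCore`). Verbatim the v5 argument of
`…CScalingBigReduction` (p128493) for the interior-range statements of reshape v6: positivity / continuity / freezing are
`stub_twoLoopAdmissible` (p124718), in-window comparability and the two-sided dyadic step law (`κ₁ = 2b₀ log 2`, `κ₃ = 0`) are
`stub_twoLoopStepLaw` (p124768), the bare size is `twoLoopCoupling_bareSize` (p128233), and the four matching clauses are exactly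
`AsymptoticScalingCoreAt r`. Hence

  `AsymptoticScalingCore → SmallTorusVarianceLaw → FemtoCurvatureTwoPointC`   (`femtoCurvatureTwoPointC_of_scalingCore_of_small`),

the explicit-units closing route of skeleton v6 (through `…CCoreBridge`: reflection positivity supplies the top of the box). Nothing is
asserted; no `sorry`.
-/

set_option autoImplicit false

noncomputable section

open Filter Topology MeasureTheory
open Literature.MathematicalPhysics.QuantumFieldTheory

namespace Summit.QuantumFields.YangMills.Theorems.FemtoCurvatureTwoPointC

/-- **The explicit two-loop coupling is an admissible AF coupling on femto boxes, interior form**: `AsymptoticScalingCoreAt r → AFProfilesCoreAt r`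
(threshold raised to `max β₀ β₈`, `β₈` the bare-size threshold; `κ₃ = 0`; window hypotheses used only at the top box). -/
theorem afProfilesCoreAt_of_asymptoticScalingCoreAt {G : Type} [Group G] [TopologicalSpace G] [IsTopologicalGroup G]
    [CompactSpace G] [MeasurableSpace G] [BorelSpace G] (r : LatticeRep G) (h : AsymptoticScalingCoreAt r) :
    AFProfilesCoreAt r := by
  obtain ⟨κ, c₀, b₀, q, u₀, β₀, c, C, hκ, hb₀, hq, hu₀, hu₀ψ, hc, hphys⟩ := h
  set T : ℕ → ℝ → ℝ := fun (L : ℕ) (β : ℝ) => max (κ * β + c₀) 1 - q * Real.log (max (κ * β + c₀) 1 + q) -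
    2 * b₀ * Real.log ((L : ℝ) / 8) with hT
  set u : ℕ → ℝ → ℝ := fun (L : ℕ) (β : ℝ) => ((1 + q) * Real.exp (min (T L β) 0) + max (T L β) 0 +
    q * (Real.log (max (T L β) 0 + Real.exp 1) - 1))⁻¹ with hu
  obtain ⟨hTL, hTU, hLU, hV⟩ := hphys T u hT hu
  obtain ⟨hpos, hcont, hfrz⟩ := stub_twoLoopAdmissible κ c₀ b₀ q hκ hq T u hT hu
  obtain ⟨κ₁, κ₂, hκ₁, hcomp, hstep⟩ := stub_twoLoopStepLaw κ c₀ b₀ q u₀ hb₀ hq hu₀ hu₀ψ T u hT hu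
  obtain ⟨c₈, β₈, hc₈, hbare⟩ := twoLoopCoupling_bareSize κ c₀ b₀ q hκ hq
  -- the local `u` is the tree's `twoLoopCoupling`
  have hu_eq : ∀ (L : ℕ) (β : ℝ), twoLoopCoupling κ c₀ b₀ q L β = u L β := fun L β => rfl
  set β₁ : ℝ := max β₀ β₈ with hβ₁
  have hβ₁₀ : β₀ ≤ β₁ := le_max_left _ _
  have hβ₁₈ : β₈ ≤ β₁ := le_max_right _ _
  refine ⟨u, u₀, β₁, κ₁, κ₂, 0, c, C, c₈, hu₀, hc, hκ₁, le_rfl, hc₈, fun L β _ _ => hpos L β,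
    fun L _ => (hcont L).continuousOn, fun L _ => hfrz L, ?_, ?_, ?_, ?_, ?_, ?_, ?_⟩
  · intro β hβ
    rw [← hu_eq]
    exact hbare β (hβ₁₈.trans hβ)
  · intro L L' β _ hL hLL' hL'L hwin
    exact hcomp L L' β hL hLL' hL'L (hwin L hL le_rfl)
  · intro k m β _ hwin
    have h8 : 8 ≤ 8 * 2 ^ (k + m) := Nat.le_mul_of_pos_right 8 (Nat.pow_pos (by norm_num))
    obtain ⟨h1, h2⟩ := hstep k m β (hwin (8 * 2 ^ (k + m)) h8 le_rfl)
    exact ⟨by linarith, by linarith⟩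
  · intro L _ β n hβ hn hnL hwin P E hP hE
    exact hTL L β n (hβ₁₀.trans hβ) hn hnL hwin P E hP hE
  · intro L _ β s hβ hL hs hsL hwin P E hP hE
    exact hTU L β s (hβ₁₀.trans hβ) hL hs hsL hwin P E hP hE
  · intro L _ β s hβ hL hs hsL hwin P E hP hE
    exact hLU L β s (hβ₁₀.trans hβ) hL hs hsL hwin P E hP hE
  · intro L _ β hβ hL hwin P E hP hE
    exact hV L β (hβ₁₀.trans hβ) hL hwin P E hP hE

/-- Universal closure: `AsymptoticScalingCore → AFProfilesCore`. -/
theorem afProfilesCore_of_asymptoticScalingCore : AsymptoticScalingCore → AFProfilesCore :=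
  fun h G _ _ _ _ _ _ hG r => afProfilesCoreAt_of_asymptoticScalingCoreAt r (h G hG r)

/-- **Explicit-units closing route of skeleton v6 (registered sub-goal)**: `AsymptoticScalingCore → SmallTorusVarianceLaw → FemtoCurvatureTwoPointC`. -/
theorem femtoCurvatureTwoPointC_of_scalingCore_of_small :
    AsymptoticScalingCore → SmallTorusVarianceLaw →
      Summit.QuantumFields.YangMills.Theses.LangevinControlUV.FemtoCurvatureTwoPointC :=
  fun h hsmall => femtoCurvatureTwoPointC_of_core_of_small (afProfilesCore_of_asymptoticScalingCore h) hsmall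

end Summit.QuantumFields.YangMills.Theorems.FemtoCurvatureTwoPointC

end
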